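import Summits.CriticalPhenomena.PercolationContinuityZ3.Theorems.SahiMasterFamilyLocalToGlobalFour
import Summits.CriticalPhenomena.PercolationContinuityZ3.Theorems.SahiMasterFamilyTerminalTight
import Summits.CriticalPhenomena.PercolationContinuityZ3.Theorems.SahiMasterFamilyStructShrink
import Summits.CriticalPhenomena.PercolationContinuityZ3.Theorems.SahiMasterFamilyStructZeroFlag
import Summits.CriticalPhenomena.PercolationContinuityZ3.Theorems.SahiMasterFamilyStructPositivity

/-!
# (TT_4) from the frame-field lemmas: `TerminalTight 1` conditional on ONE combinatorial statement (FrameFieldDisjoint)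

Unit `prim-master-conj` (crux anchor stmt-CriticalPhenomena-4575), gen 11; memo HOME/prim-master-conj/TIGHTNESS-III.md §3.
THEOREM LG4 (`GluedFrames.lg4_of_noAbsorber`) is the local-to-global step at order four.  The assembly of (TT_4) = `TerminalTight 1` needs, besides
LG4 and the trivial cases (no core-free coordinate ⟹ the cap is `{univ}`), exactly one more input (proved in the next file):

  **`FrameFieldDisjoint`**: for a terminal quadruple on the full coordinate set with a core-free coordinate and NON-principal common part,
  the glued frames have pairwise disjoint essential supports.

This file: (1) RESTRICTION TO A DETERMINING SET — events determined by `S` are pulled back to events on the subtype `↥S`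
(`pull`), preserving/reflecting increasing-ness, emptiness, sections, pivotality, `DeterminedBy`, the zero-flag class `SuppZeroFlag` (both
directions), inclusions and principal caps; (2) `terminalTight_of_univ` — `TerminalTight n` follows from its instances with `S = univ`;
(3) **`terminalTight_one_of_frameFieldDisjoint : FrameFieldDisjoint → TerminalTight 1`**, hence
**`masterFamilyIdentEqIff_four_of_frameFieldDisjoint : FrameFieldDisjoint → MasterFamilyIdentEqIff 4`**.
`FrameFieldDisjoint` is typed here as a `def … : Prop` and used as a HYPOTHESIS; it is PROVED in the next file
`SahiMasterFamilyFrameFieldDisjoint` (`frameFieldDisjoint_holds`), which then derives `terminalTight_one` and `masterFamilyIdentEqIff_four`.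
Axioms standard. [this work]
-/

noncomputable section

open scoped Classical

namespace Summit.CriticalPhenomena.PercolationContinuityZ3.Theorems

namespace GluedFrames

open Finset Function
open Literature.Probability.LatticeModels.Kahn2022 (Affects)
open Literature.Probability.Percolation (DeterminedBy determinedBy_iff)

/-! ### Restriction of events to a determining set -/

section Pull

variable {ι : Type*} (S : Finset ι)

/-- Pull-back of an event on `ι` to an event on the coordinates `↥S`: `T' ↦ [val '' T' ∈ A]`. [this work] -/
def pull (A : Set (Set ι)) : Set (Set ↥S) := {T' | Subtype.val '' T' ∈ A}

/-- Membership in the pull-back. [this work] -/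
@[simp] theorem mem_pull {A : Set (Set ι)} {T' : Set ↥S} : T' ∈ pull S A ↔ Subtype.val '' T' ∈ A := Iff.rfl

/-- `val '' (val ⁻¹' ω) = ω ∩ S`. [folklore] -/
theorem image_preimage_val (ω : Set ι) : Subtype.val '' ((Subtype.val : ↥S → ι) ⁻¹' ω) = ω ∩ ↑S := by
  ext x
  constructor
  · rintro ⟨y, hy, rfl⟩; exact ⟨hy, y.2⟩
  · rintro ⟨hx, hxS⟩; exact ⟨⟨x, hxS⟩, hx, rfl⟩

/-- For an event determined by `S`: `ω ∈ A ↔ val ⁻¹' ω ∈ pull S A`. [this work] -/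
theorem mem_iff_preimage_mem_pull {A : Set (Set ι)} (hA : DeterminedBy A (↑S : Set ι)) (ω : Set ι) :
    ω ∈ A ↔ (Subtype.val : ↥S → ι) ⁻¹' ω ∈ pull S A := by
  rw [mem_pull, image_preimage_val]
  exact (determinedBy_iff A ↑S).1 hA ω (ω ∩ ↑S) (by rw [Set.inter_assoc, Set.inter_self])

/-- The image of a configuration of `↥S` lies inside `S`. [folklore] -/
theorem image_val_subset (T' : Set ↥S) : Subtype.val '' T' ⊆ (↑S : Set ι) := by
  rintro x ⟨y, -, rfl⟩; exact y.2

omit S in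
/-- Images under `val` of configurations agreeing on `val ⁻¹' F` agree on `F`. [folklore] -/
theorem image_inter_eq_of_inter_preimage_eq {S : Finset ι} {F : Set ι} {T₁ T₂ : Set ↥S}
    (h : T₁ ∩ Subtype.val ⁻¹' F = T₂ ∩ Subtype.val ⁻¹' F) : Subtype.val '' T₁ ∩ F = Subtype.val '' T₂ ∩ F := by
  ext x
  constructor
  · rintro ⟨⟨y, hy, rfl⟩, hxF⟩
    have : y ∈ T₂ ∩ Subtype.val ⁻¹' F := by rw [← h]; exact ⟨hy, hxF⟩
    exact ⟨⟨y, this.1, rfl⟩, hxF⟩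
  · rintro ⟨⟨y, hy, rfl⟩, hxF⟩
    have : y ∈ T₁ ∩ Subtype.val ⁻¹' F := by rw [h]; exact ⟨hy, hxF⟩
    exact ⟨⟨y, this.1, rfl⟩, hxF⟩

/-- Pull-backs of increasing events are increasing. [this work] -/
theorem isUpperSet_pull {A : Set (Set ι)} (hA : IsUpperSet A) : IsUpperSet (pull S A) :=
  fun _ _ hle h => hA (Set.image_mono hle) h

/-- Pull-back of a non-empty event determined by `S` is non-empty. [this work] -/
theorem pull_nonempty {A : Set (Set ι)} (hA : DeterminedBy A (↑S : Set ι)) (hne : A.Nonempty) : (pull S A).Nonempty := by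
  obtain ⟨ω, hω⟩ := hne
  exact ⟨_, (mem_iff_preimage_mem_pull S hA ω).1 hω⟩

/-- `∅ ∉ A ⟹ ∅ ∉ pull S A`. [this work] -/
theorem empty_not_mem_pull {A : Set (Set ι)} (h0 : (∅ : Set ι) ∉ A) : (∅ : Set ↥S) ∉ pull S A := by
  rw [mem_pull, Set.image_empty]; exact h0

/-- `pull` commutes with intersections. [this work] -/
theorem pull_inter (A B : Set (Set ι)) : pull S (A ∩ B) = pull S A ∩ pull S B := rfl

/-- `pull` commutes with sections (`e ∈ S`). [this work] -/
theorem pull_secAt (A : Set (Set ι)) (e : ↥S) (b : Bool) : pull S (secAt (e : ι) b A) = secAt e b (pull S A) := by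
  ext T'
  rw [mem_pull, mem_secAt, mem_secAt, mem_pull]
  cases b
  · simp only [forceAt, cond_false]
    rw [Set.image_sdiff Subtype.val_injective, Set.image_singleton]
  · simp only [forceAt, cond_true, Set.image_insert_eq]

/-- Pivotality transfers to the pull-back (event determined by `S`, coordinate in `S`). [this work] -/
theorem affects_pull_iff {A : Set (Set ι)} (hA : DeterminedBy A (↑S : Set ι)) (e : ↥S) : Affects (pull S A) e ↔ Affects A (e : ι) := by
  constructor
  · rintro ⟨T', hT', hins⟩
    refine ⟨Subtype.val '' T', hT', ?_⟩
    rw [mem_pull, Set.image_insert_eq] at hins; exact hins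
  · rintro ⟨ω, hω, hins⟩
    refine ⟨Subtype.val ⁻¹' ω, fun h => hω ((mem_iff_preimage_mem_pull S hA ω).2 h), ?_⟩
    have : insert e ((Subtype.val : ↥S → ι) ⁻¹' ω) = Subtype.val ⁻¹' (insert (e : ι) ω) := by
      ext y
      simp only [Set.mem_insert_iff, Set.mem_preimage]
      constructor
      · rintro (rfl | h)
        · exact Or.inl rfl
        · exact Or.inr h
      · rintro (h | h)
        · exact Or.inl (Subtype.ext h)
        · exact Or.inr h
    rw [this]
    exact (mem_iff_preimage_mem_pull S hA _).1 hins

/-- `DeterminedBy` transfers to the pull-back. [this work] -/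
theorem determinedBy_pull {A : Set (Set ι)} {F : Set ι} (hF : DeterminedBy A F) : DeterminedBy (pull S A) (Subtype.val ⁻¹' F) := by
  rw [determinedBy_iff] at hF ⊢
  intro T₁ T₂ h
  rw [mem_pull, mem_pull]
  exact hF _ _ (image_inter_eq_of_inter_preimage_eq h)

/-- `DeterminedBy` transfers back from the pull-back (event determined by `S`). [this work] -/
theorem determinedBy_of_pull {A : Set (Set ι)} (hA : DeterminedBy A (↑S : Set ι)) {F' : Set ↥S} (hF : DeterminedBy (pull S A) F') :
    DeterminedBy A (Subtype.val '' F') := by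
  rw [determinedBy_iff] at hF ⊢
  intro ω₁ ω₂ h
  rw [mem_iff_preimage_mem_pull S hA ω₁, mem_iff_preimage_mem_pull S hA ω₂]
  refine hF _ _ ?_
  ext y
  simp only [Set.mem_inter_iff, Set.mem_preimage]
  have key : (y : ι) ∈ ω₁ ∩ Subtype.val '' F' ↔ (y : ι) ∈ ω₂ ∩ Subtype.val '' F' := by rw [h]
  simp only [Set.mem_inter_iff, Set.mem_image, Subtype.exists, exists_and_right, exists_eq_right] at key
  constructor
  · rintro ⟨h1, h2⟩; exact ⟨(key.1 ⟨h1, y.2, h2⟩).1, h2⟩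
  · rintro ⟨h1, h2⟩; exact ⟨(key.2 ⟨h1, y.2, h2⟩).1, h2⟩

/-- **Zero flags transfer to the pull-back.** [this work] -/
theorem suppZeroFlag_pull : ∀ (k : ℕ) (U : Fin k → Set (Set ι)), SuppZeroFlag k U → SuppZeroFlag k (fun j => pull S (U j))
  | 0, _, _ => trivial
  | 1, U, h => by
    show pull S (U 0) = ∅
    have h0 : U 0 = ∅ := h
    ext T'; rw [mem_pull, h0]; simp
  | 2, U, ⟨A, B, hAB, hA, hB⟩ => by
    refine ⟨univ.filter fun y : ↥S => (y : ι) ∈ A, univ.filter fun y : ↥S => (y : ι) ∈ B, ?_, ?_, ?_⟩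
    · rw [Finset.disjoint_left]; intro y hyA hyB
      rw [mem_filter] at hyA hyB
      exact Finset.disjoint_left.1 hAB hyA.2 hyB.2
    · have e : (↑(univ.filter fun y : ↥S => (y : ι) ∈ A) : Set ↥S) = Subtype.val ⁻¹' (↑A : Set ι) := by ext y; simp
      rw [e]; exact determinedBy_pull S hA
    · have e : (↑(univ.filter fun y : ↥S => (y : ι) ∈ B) : Set ↥S) = Subtype.val ⁻¹' (↑B : Set ι) := by ext y; simp
      rw [e]; exact determinedBy_pull S hB
  | k + 3, U, ⟨i, h1, h2⟩ => by
    refine ⟨i, suppZeroFlag_pull (k + 2) _ h1, fun l => ?_⟩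
    have := suppZeroFlag_pull (k + 2) _ (h2 l)
    convert this using 1
    funext j
    by_cases hj : j = l
    · subst hj; simp only [update_self, pull_inter]
    · simp only [update_of_ne hj]

/-- **Zero flags transfer back from the pull-back** (members determined by `S`). [this work] -/
theorem suppZeroFlag_of_pull : ∀ (k : ℕ) (U : Fin k → Set (Set ι)), (∀ j, DeterminedBy (U j) (↑S : Set ι)) →
    SuppZeroFlag k (fun j => pull S (U j)) → SuppZeroFlag k U
  | 0, _, _, _ => trivial
  | 1, U, hU, h => by
    have h0 : pull S (U 0) = ∅ := h
    show U 0 = ∅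
    ext ω
    simp only [Set.mem_empty_iff_false, iff_false]
    intro hω
    have := (mem_iff_preimage_mem_pull S (hU 0) ω).1 hω
    rw [h0] at this; exact this
  | 2, U, hU, ⟨A, B, hAB, hA, hB⟩ => by
    refine ⟨A.image Subtype.val, B.image Subtype.val, ?_, ?_, ?_⟩
    · rw [Finset.disjoint_left]; intro x hxA hxB
      rw [mem_image] at hxA hxB
      obtain ⟨y, hy, rfl⟩ := hxA
      obtain ⟨y', hy', hyy⟩ := hxB
      have : y' = y := Subtype.val_injective hyy
      subst this
      exact Finset.disjoint_left.1 hAB hy hy'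
    · rw [coe_image]; exact determinedBy_of_pull S (hU 0) hA
    · rw [coe_image]; exact determinedBy_of_pull S (hU 1) hB
  | k + 3, U, hU, ⟨i, h1, h2⟩ => by
    refine ⟨i, suppZeroFlag_of_pull (k + 2) _ (fun j => hU _) h1, fun l => ?_⟩
    refine suppZeroFlag_of_pull (k + 2) _ (fun j => ?_) ?_
    · by_cases hj : j = l
      · subst hj; simp only [update_self]
        exact Literature.Probability.Percolation.DeterminedBy.inter (hU _) (hU _)
      · simp only [update_of_ne hj]; exact hU _
    · have := h2 l
      convert this using 1
      funext j
      by_cases hj : j = l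
      · subst hj; simp only [update_self, pull_inter]
      · simp only [update_of_ne hj]

/-- Inclusions transfer back (events determined by `S`). [this work] -/
theorem subset_of_pull_subset {A B : Set (Set ι)} (hA : DeterminedBy A (↑S : Set ι)) (hB : DeterminedBy B (↑S : Set ι))
    (h : pull S A ⊆ pull S B) : A ⊆ B := fun ω hω =>
  (mem_iff_preimage_mem_pull S hB ω).2 (h ((mem_iff_preimage_mem_pull S hA ω).1 hω))

/-- A principal cap transfers back (events determined by `S`). [this work] -/
theorem principalCap_of_pull {k : ℕ} {U : Fin k → Set (Set ι)} (hU : ∀ j, DeterminedBy (U j) (↑S : Set ι)) {c' : Finset ↥S}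
    (hc : ∀ T' : Set ↥S, (∀ j, T' ∈ pull S (U j)) ↔ (↑c' : Set ↥S) ⊆ T') :
    ∀ T : Set ι, (∀ j, T ∈ U j) ↔ (↑(c'.image Subtype.val) : Set ι) ⊆ T := by
  intro T
  rw [coe_image]
  constructor
  · intro h
    have h' : ∀ j, (Subtype.val : ↥S → ι) ⁻¹' T ∈ pull S (U j) := fun j => (mem_iff_preimage_mem_pull S (hU j) T).1 (h j)
    have hsub := (hc _).1 h'
    rintro x ⟨y, hy, rfl⟩
    exact hsub hy
  · intro h j
    refine (mem_iff_preimage_mem_pull S (hU j) T).2 (((hc _).2 fun y hy => ?_) j)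
    exact h ⟨y, hy, rfl⟩

end Pull

/-! ### `TerminalTight` from the full-coordinate case -/

/-- The hypotheses and conclusion of `TerminalTight n` for ONE family (stated to be reused with `S = univ`). [this work] -/
def TerminalTightAt (n : ℕ) (ι : Type) [Fintype ι] (U : Fin (n + 3) → Set (Set ι)) (S : Finset ι) : Prop :=
  (∀ j, IsUpperSet (U j)) → (∀ j, DeterminedBy (U j) (↑S : Set ι)) →
    (∀ j, (U j).Nonempty) → (∀ j, (∅ : Set ι) ∉ U j) →
    (∀ m : Fin (n + 3), ¬ SuppZeroFlag (n + 2) (fun j => U (m.succAbove j))) →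
    (¬ ∃ e : ι, ∀ j, ∃ ω, e ∉ ω ∧ ω ∉ U j ∧ insert e ω ∈ U j) →
    (¬ ∃ e : ι, ∃ c : Fin (n + 3), (∃ ω, e ∉ ω ∧ ω ∉ U c ∧ insert e ω ∈ U c) ∧ ∀ j, j ≠ c → ¬ Affects (U j) e) →
    (∀ e ∈ S, ∀ b : Bool, SuppZeroFlag (n + 3) (fun j => secAt e b (U j))) →
    (∀ j, ∃ l, l ≠ j ∧ ¬ U l ⊆ U j) →
      ∃ c : Finset ι, ∀ T : Set ι, (∀ j, T ∈ U j) ↔ (↑c : Set ι) ⊆ T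

/-- `TerminalTight n` is the conjunction of its instances. [this work] -/
theorem terminalTight_iff (n : ℕ) : TerminalTight n ↔ ∀ (ι : Type) [Fintype ι] (U : Fin (n + 3) → Set (Set ι)) (S : Finset ι),
    TerminalTightAt n ι U S := Iff.rfl

/-- **Restriction**: the instance at `(ι, U, S)` follows from the instance at `(↥S, pull S ∘ U, univ)`. [this work] -/
theorem terminalTightAt_of_pull (n : ℕ) (ι : Type) [Fintype ι] (U : Fin (n + 3) → Set (Set ι)) (S : Finset ι)
    (h : TerminalTightAt n ↥S (fun j => pull S (U j)) univ) : TerminalTightAt n ι U S := by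
  intro hU hUS hne h0 hno hc hpriv hall habs
  have hU' : ∀ j, IsUpperSet (pull S (U j)) := fun j => isUpperSet_pull S (hU j)
  have hdet' : ∀ j, DeterminedBy (pull S (U j)) (↑(univ : Finset ↥S) : Set ↥S) := by
    intro j; rw [coe_univ, determinedBy_iff]; intro ω ω' h; rw [Set.inter_univ, Set.inter_univ] at h; rw [h]
  obtain ⟨c', hc'⟩ := h hU' hdet' (fun j => pull_nonempty S (hUS j) (hne j)) (fun j => empty_not_mem_pull S (h0 j))
    (fun m hm => hno m (suppZeroFlag_of_pull S (n + 2) _ (fun j => hUS _) hm))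
    (by
      rintro ⟨e, he⟩
      refine hc ⟨(e : ι), fun j => ?_⟩
      obtain ⟨T', heT, hT, hins⟩ := he j
      have ha : Affects (pull S (U j)) e := ⟨T', hT, hins⟩
      obtain ⟨ω, hω, hω'⟩ := (affects_pull_iff S (hUS j) e).1 ha
      exact ⟨ω \ {(e : ι)}, fun h => h.2 rfl, fun h => hω (hU j Set.sdiff_subset h),
        by rw [Set.insert_sdiff_singleton]; exact hω'⟩)
    (by
      rintro ⟨e, c, ⟨T', heT, hT, hins⟩, hothers⟩
      refine hpriv ⟨(e : ι), c, ?_, fun j hj ha => hothers j hj ((affects_pull_iff S (hUS j) e).2 ha)⟩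
      obtain ⟨ω, hω, hω'⟩ := (affects_pull_iff S (hUS c) e).1 ⟨T', hT, hins⟩
      exact ⟨ω \ {(e : ι)}, fun h => h.2 rfl, fun h => hω (hU c Set.sdiff_subset h),
        by rw [Set.insert_sdiff_singleton]; exact hω'⟩)
    (fun e _ b => by
      have := suppZeroFlag_pull S (n + 3) _ (hall (e : ι) e.2 b)
      convert this using 1
      funext j; exact (pull_secAt S (U j) e b).symm)
    (fun j => by
      obtain ⟨l, hlj, hnot⟩ := habs j
      exact ⟨l, hlj, fun hsub => hnot (subset_of_pull_subset S (hUS l) (hUS j) hsub)⟩)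
  exact ⟨c'.image Subtype.val, principalCap_of_pull S hUS hc'⟩

/-- **`TerminalTight n` from its full-coordinate instances.** [this work] -/
theorem terminalTight_of_univ (n : ℕ)
    (h : ∀ (ι : Type) [Fintype ι] (U : Fin (n + 3) → Set (Set ι)), TerminalTightAt n ι U univ) : TerminalTight n :=
  (terminalTight_iff n).2 fun ι _ U S => terminalTightAt_of_pull n ι U S (h _ _)

/-! ### The one remaining input, and the assembly at order four -/

/-- **FRAME-FIELD DISJOINTNESS** (TIGHTNESS §4.11 + TIGHTNESS-II (D0)–(D4) + THEOREM TRI; paper-proved, unrefereed; NOT formalised): for a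
terminal quadruple of increasing, non-empty, non-sure events determined by all coordinates (no zero-flag deletion, no common pivotal coordinate, no
private coordinate, all minors zero flags, no member containing the others), with a core-free coordinate and a NON-principal common part, the glued
frames have pairwise disjoint essential supports.  PROVED in `SahiMasterFamilyFrameFieldDisjoint` (`GluedFrames.frameFieldDisjoint_holds`, a short
glued-language argument); stated here as a named `Prop` so that the assembly below is independent of that proof. [this work] -/
def FrameFieldDisjoint : Prop :=
  ∀ (ι : Type) [Fintype ι] (U : Fin 4 → Set (Set ι)), (∀ j, IsUpperSet (U j)) →
    (∀ j, (U j).Nonempty) → (∀ j, (∅ : Set ι) ∉ U j) →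
    (∀ m : Fin 4, ¬ SuppZeroFlag 3 (fun j => U (m.succAbove j))) →
    (¬ ∃ e : ι, ∀ j, ∃ ω, e ∉ ω ∧ ω ∉ U j ∧ insert e ω ∈ U j) →
    (¬ ∃ e : ι, ∃ c : Fin 4, (∃ ω, e ∉ ω ∧ ω ∉ U c ∧ insert e ω ∈ U c) ∧ ∀ j, j ≠ c → ¬ Affects (U j) e) →
    (∀ e : ι, ∀ b : Bool, SuppZeroFlag 4 (fun j => secAt e b (U j))) →
    (∀ j, ∃ l, l ≠ j ∧ ¬ U l ⊆ U j) →
    (∃ f, CoreFree U f) → (¬ ∃ c : Finset ι, ∀ T : Set ι, (∀ j, T ∈ U j) ↔ (↑c : Set ι) ⊆ T) →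
      ∀ x x' : Fin 4, x ≠ x' → Disjoint (esupp (gframe U univ x)) (esupp (gframe U univ x'))

/-- **(TT_4) on the full coordinate set, from `FrameFieldDisjoint` and THEOREM LG4.** [this work] -/
theorem terminalTightAt_one_univ (hFFD : FrameFieldDisjoint) (ι : Type) [Fintype ι] (U : Fin 4 → Set (Set ι)) :
    TerminalTightAt 1 ι U univ := by
  intro hU _ hne h0 hno hc hpriv hall habs
  by_contra hcap
  -- a core-free coordinate exists (else the cap is `{univ}`, principal)
  have hE0 : ∃ f, CoreFree U f := by
    by_contra hnone
    push Not at hnone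
    refine hcap ⟨univ, fun T => ⟨fun hT => ?_, fun hT j => ?_⟩⟩
    · rw [coe_univ, Set.univ_subset_iff]
      by_contra hTu
      obtain ⟨f, hf⟩ := (Set.ne_univ_iff_exists_notMem T).1 hTu
      obtain ⟨k, hk⟩ : ∃ k, Set.univ \ {f} ∉ U k := by
        have := hnone f; unfold CoreFree at this; push Not at this; exact this
      exact hk (hU k (fun x hx => ⟨Set.mem_univ x, fun hxf => hf (hxf ▸ hx)⟩ : T ⊆ Set.univ \ {f}) (hT k))
    · rw [coe_univ, Set.univ_subset_iff] at hT; subst hT; exact univ_mem_of_nonempty (hU j) (hne j)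
  have hns : ∀ k, U k ≠ Set.univ := fun k hk => h0 k (hk ▸ Set.mem_univ _)
  -- at least two coordinates (else all members coincide with the unique non-trivial up-set and absorb each other)
  have hι : ∀ f : ι, ∃ h, h ≠ f := by
    intro f
    by_contra hsub
    push Not at hsub
    -- every member contains `univ ∖ {f} = ∅`-or-... : with one coordinate, a non-empty non-sure up-set is `{ω | f ∈ ω}`
    have hmem : ∀ j (ω : Set ι), ω ∈ U j ↔ f ∈ ω := by
      intro j ω
      constructor
      · intro hω; by_contra hfω
        have : ω = ∅ := Set.eq_empty_of_forall_notMem fun x hx => hfω ((hsub x) ▸ hx)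
        exact h0 j (this ▸ hω)
      · intro hfω
        have : ω = Set.univ := Set.eq_univ_of_forall fun x => (hsub x).symm ▸ hfω
        rw [this]; exact univ_mem_of_nonempty (hU j) (hne j)
    obtain ⟨l, -, hnot⟩ := habs 0
    exact hnot fun ω hω => (hmem 0 ω).2 ((hmem l ω).1 hω)
  -- faces structured
  have hne' : ∀ h k, (secAt h true (U k)).Nonempty := fun h k => faceT_nonempty U hU hne h k
  have hS : ∀ h, Structured (faceT U h) univ := by
    intro h
    have hz : SuppZeroFlag (2 + 2) (fun j => faceT U h (id j)) := by exact hall h (mem_univ _) true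
    have := structured_of_suppZeroFlag 2 (faceT U h) (isUpperSet_faceT U hU h) (hne' h) id injective_id hz
    convert this using 2; simp
  have hF : ∀ f, CoreFree U f → Structured (faceF U f) univ := by
    intro f hf
    have hz : SuppZeroFlag (2 + 2) (fun j => faceF U f (id j)) := by exact hall f (mem_univ _) false
    have := structured_of_suppZeroFlag 2 (faceF U f) (isUpperSet_faceF U hU f) (faceF_nonempty U hf) id injective_id hz
    convert this using 2; simp
  have hd := hFFD ι U hU hne h0 hno hc hpriv (fun e b => by exact hall e (mem_univ e) b) habs hE0 hcap
  refine lg4_of_noAbsorber U univ hU hne hns (fun k => mem_univ k) (by simp) hS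
    (fun x _ x' _ hxx' => hd x x' hxx') hF hE0 hι (fun l _ => by obtain ⟨m, hm, h⟩ := habs l; exact ⟨m, mem_univ m, hm, h⟩) ?_
  intro x _ hs
  apply hno x
  refine suppZeroFlag_of_structured 1 U hU hne (fun j => x.succAbove j) Fin.succAbove_right_injective ?_
  convert hs using 2
  ext j
  simp [Fin.exists_succAbove_eq_iff]

/-- **`FrameFieldDisjoint → TerminalTight 1`.** [this work] -/
theorem terminalTight_one_of_frameFieldDisjoint (hFFD : FrameFieldDisjoint) : TerminalTight 1 :=
  terminalTight_of_univ 1 fun ι _ U => terminalTightAt_one_univ hFFD ι U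

/-- **The identically-zero master conjecture at order four from frame-field disjointness alone**:
`FrameFieldDisjoint → MasterFamilyIdentEqIff 4`. [this work] -/
theorem masterFamilyIdentEqIff_four_of_frameFieldDisjoint (hFFD : FrameFieldDisjoint) : MasterFamilyIdentEqIff 4 :=
  masterFamilyIdentEqIff_four_of_terminalTight (terminalTight_one_of_frameFieldDisjoint hFFD)

end GluedFrames

end Summit.CriticalPhenomena.PercolationContinuityZ3.Theorems
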